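import Literature.NumberTheory.GaloisRepresentations.ContinuousCohomologyConnecting
import Literature.NumberTheory.GaloisRepresentations.ContinuousH3
import HarnessLib

/-!
# The nine-term cohomology sequence `H⁰ → H¹ → H²` and the Euler-characteristic count

Topic `NumberTheory/GaloisRepresentations`; namespace `Literature.NumberTheory.GaloisRepresentations`.
Theorems only (no definition, no named fact; D-0026).

For a short exact sequence `0 → M₁ →(f) M₂ →(g) M₃ → 0` of discrete modules over a locally compact
group `Γ` (`IsSES`, `ContinuousCohomologyConnecting.lean`) this file completes the tree's long exact
cohomology sequence (Serre, *Cohomologie galoisienne*, I §2.2) in the top degree it reaches: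

* `IsSES.exists_map_two_eq_of_subsingleton_three` — **exactness at `H²(Γ, M₃)`**: if
  `H³(Γ, M₁) = 0` then `H²(g) : H²(Γ, M₂) → H²(Γ, M₃)` is surjective (lift a `2`-cocycle `z` of `M₃`
  to a continuous cochain `z̃` of `M₂`; `f⁻¹(d z̃)` is a continuous `3`-cocycle of `M₁`, hence
  `= db` (`threeCocycleClass_eq_zero_iff_dTwo`), and `z̃ - f ∘ b` is a cocycle lifting `z`);
* `IsSES.map_one_map_one`, `IsSES.map_two_map_two` — `H^q(g) ∘ H^q(f) = 0`, `q = 1, 2`;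
* `IsSES.card_nineTerm` — **the Euler-characteristic count**: when the nine groups are finite and
  `H³(Γ, M₁) = 0`,
  `#M₁^Γ · #M₃^Γ · #H¹(M₂) · #H²(M₁) · #H²(M₃) = #M₂^Γ · #H¹(M₁) · #H¹(M₃) · #H²(M₂)`, i.e.
  `χ(M₂) = χ(M₁) χ(M₃)` for `χ(M) = #H⁰(M) #H²(M) / #H¹(M)` ("both sides are additive in `M`",
  Milne, *Arithmetic Duality Theorems*, I §2, proof of Thm. 2.8; Serre II §5.4), from the exactness
  of `0 → M₁^Γ → M₂^Γ → M₃^Γ → H¹(M₁) → H¹(M₂) → H¹(M₃) → H²(M₁) → H²(M₂) → H²(M₃) → 0` and the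
  count `#B = #im(A → B) · #im(B → C)` (`card_eq_card_range_mul_of_exact`).

## References
* J.-P. Serre, *Cohomologie galoisienne* / *Galois Cohomology* (1997), I §2.2 (suite exacte de
  cohomologie), II §5.4 (caractéristique d'Euler–Poincaré). [SerreGaloisCohomology1997]
* J. S. Milne, *Arithmetic Duality Theorems*, 2nd ed. (2006), I §2, Thm. 2.8 (proof: additivity of
  `χ`). [MilneADT2006]
-/

noncomputable section

open CategoryTheory Function

universe u

namespace Literature.NumberTheory.GaloisRepresentations

open _root_.TopRep _root_.ContRepresentation _root_.ContinuousCohomology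

/-! ### Counting along exact sequences of finite groups -/

section Counting

/-- **`#B = #im(A → B) · #im(B → C)`** for an exact sequence `A → B → C` of additive groups with `B`
finite. [folklore] -/
theorem card_eq_card_range_mul_of_exact {α β γ : Type*} [AddGroup α] [AddGroup β] [AddGroup γ]
    [Finite β] (φ : α →+ β) (ψ : β →+ γ) (h₁ : ∀ a, ψ (φ a) = 0)
    (h₂ : ∀ b, ψ b = 0 → ∃ a, φ a = b) :
    Nat.card β = Nat.card φ.range * Nat.card ψ.range := by
  have hker : ψ.ker = φ.range := by
    ext b
    rw [AddMonoidHom.mem_ker, AddMonoidHom.mem_range]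
    exact ⟨h₂ b, by rintro ⟨a, rfl⟩; exact h₁ a⟩
  rw [AddSubgroup.card_eq_card_quotient_mul_card_addSubgroup ψ.ker,
    Nat.card_congr (QuotientAddGroup.quotientKerEquivRange ψ).toEquiv, hker, mul_comm]

/-- `#im φ = #A` for `φ` injective. [folklore] -/
theorem card_range_of_injective' {α β : Type*} [AddGroup α] [AddGroup β] (φ : α →+ β)
    (hφ : Injective φ) : Nat.card φ.range = Nat.card α :=
  (Nat.card_congr (AddMonoidHom.ofInjective hφ).toEquiv).symm

/-- `#im ψ = #C` for `ψ` surjective. [folklore] -/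
theorem card_range_of_surjective' {β γ : Type*} [AddGroup β] [AddGroup γ] (ψ : β →+ γ)
    (hψ : Surjective ψ) : Nat.card ψ.range = Nat.card γ := by
  rw [AddMonoidHom.range_eq_top.2 hψ, AddSubgroup.card_top]

end Counting

/-! ### Exactness at `H²(Γ, M₃)` and the nine-term count -/

section NineTerm

variable {A : Type*} [CommRing A] [TopologicalSpace A]
variable {Γ : Type u} [Group Γ] [TopologicalSpace Γ] [IsTopologicalGroup Γ] [LocallyCompactSpace Γ]
variable {M₁ : Type u} [AddCommGroup M₁] [Module A M₁] [TopologicalSpace M₁] [DiscreteTopology M₁]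
  [ContinuousSMul A M₁]
variable {M₂ : Type u} [AddCommGroup M₂] [Module A M₂] [TopologicalSpace M₂] [DiscreteTopology M₂]
  [ContinuousSMul A M₂]
variable {M₃ : Type u} [AddCommGroup M₃] [Module A M₃] [TopologicalSpace M₃] [DiscreteTopology M₃]
  [ContinuousSMul A M₃]
variable {ρ₁ : ContinuousRep Γ A M₁} {ρ₂ : ContinuousRep Γ A M₂} {ρ₃ : ContinuousRep Γ A M₃}
variable {f : ρ₁.toTopRep ⟶ ρ₂.toTopRep} {g : ρ₂.toTopRep ⟶ ρ₃.toTopRep}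

namespace IsSES

omit [LocallyCompactSpace Γ] in
/-- The coboundary of a continuous `2`-cochain is continuous (jointly continuous action). [folklore] -/
theorem continuous_dTwo (b : C(Γ × Γ, M₂)) :
    Continuous fun p : Γ × Γ × Γ => dTwo ρ₂.toTopRep b p.1 p.2.1 p.2.2 := by
  change Continuous fun p : Γ × Γ × Γ =>
    ρ₂ p.1 (b (p.2.1, p.2.2)) - b (p.1 * p.2.1, p.2.2) + b (p.1, p.2.1 * p.2.2) - b (p.1, p.2.1)
  refine (((ρ₂.continuous_apply₂.comp (continuous_fst.prodMk (b.continuous.comp continuous_snd))).sub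
    (b.continuous.comp ((continuous_fst.mul (continuous_fst.comp continuous_snd)).prodMk
      (continuous_snd.comp continuous_snd)))).add
    (b.continuous.comp (continuous_fst.prodMk ((continuous_fst.comp continuous_snd).mul
      (continuous_snd.comp continuous_snd))))).sub
    (b.continuous.comp (continuous_fst.prodMk (continuous_fst.comp continuous_snd)))

omit [LocallyCompactSpace Γ] in
/-- **`d ∘ d = 0`**: the coboundary of a continuous `2`-cochain satisfies the `3`-cocycle identity.
[cite: SerreGaloisCohomology1997, I §2.2] -/
theorem dTwo_mem_contThreeCocycles (b : C(Γ × Γ, M₂)) :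
    (⟨fun p : Γ × Γ × Γ => dTwo ρ₂.toTopRep b p.1 p.2.1 p.2.2, continuous_dTwo b⟩ : C(Γ × Γ × Γ, M₂)) ∈
      contThreeCocycles ρ₂.toTopRep := by
  intro σ τ υ ω
  change ρ₂ σ (ρ₂ τ (b (υ, ω)) - b (τ * υ, ω) + b (τ, υ * ω) - b (τ, υ)) +
      (ρ₂ σ (b (τ * υ, ω)) - b (σ * (τ * υ), ω) + b (σ, τ * υ * ω) - b (σ, τ * υ)) +
      (ρ₂ σ (b (τ, υ)) - b (σ * τ, υ) + b (σ, τ * υ) - b (σ, τ)) =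
    (ρ₂ (σ * τ) (b (υ, ω)) - b (σ * τ * υ, ω) + b (σ * τ, υ * ω) - b (σ * τ, υ)) +
      (ρ₂ σ (b (τ, υ * ω)) - b (σ * τ, υ * ω) + b (σ, τ * (υ * ω)) - b (σ, τ))
  rw [_root_.map_mul ρ₂, Module.End.mul_apply, map_sub, map_add, map_sub, mul_assoc, mul_assoc]
  abel

/-- **Exactness at `H²(Γ, M₃)`**: if `H³(Γ, M₁) = 0`, every class of `H²(Γ, M₃)` lifts to
`H²(Γ, M₂)` (Serre I §2.2: `H²(B) → H²(C) → H³(A)` is exact; lift a cocycle to a continuous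
cochain `z̃`, write the `3`-cocycle `f⁻¹(dz̃) = db`, and correct `z̃` by `f ∘ b`).
[cite: SerreGaloisCohomology1997, I §2.2] -/
theorem exists_map_two_eq_of_subsingleton_three (h : IsSES f g)
    [Subsingleton (continuousCohomology 3 ρ₁.toTopRep)] (x : continuousCohomology 2 ρ₃.toTopRep) :
    ∃ y : continuousCohomology 2 ρ₂.toTopRep, cohomologyMap g 2 y = x := by
  obtain ⟨z, rfl⟩ := twoCocycleClass_surjective _ x
  -- a continuous lift `z̃ : Γ × Γ → M₂` of the cocycle `z`
  let zt : C(Γ × Γ, M₂) :=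
    ⟨h.lift ∘ z.1, (continuous_of_discreteTopology (f := h.lift)).comp z.1.continuous⟩
  have hzt : ∀ p, g.hom (zt p) = z.1 p := fun p => h.g_lift _
  -- `d z̃` takes values in `ker g = im f`
  have hd : ∀ σ τ υ, g.hom (dTwo ρ₂.toTopRep zt σ τ υ) = 0 := fun σ τ υ => by
    rw [dTwo_apply, map_sub, map_add, map_sub, TopRep.hom_comm_apply g σ, hzt, hzt, hzt, hzt]
    exact dTwo_coe_contTwoCocycles ρ₃.toTopRep z σ τ υ
  -- the continuous `3`-cocycle `c = f⁻¹(d z̃)` of `M₁`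
  let c : contThreeCocycles ρ₁.toTopRep :=
    ⟨⟨fun p => h.inv (dTwo ρ₂.toTopRep zt p.1 p.2.1 p.2.2),
        (continuous_of_discreteTopology (f := h.inv)).comp (continuous_dTwo zt)⟩, fun σ τ υ ω => by
      apply h.injective
      have key := dTwo_mem_contThreeCocycles (ρ₂ := ρ₂) zt σ τ υ ω
      change ρ₂ σ (dTwo ρ₂.toTopRep zt τ υ ω) + dTwo ρ₂.toTopRep zt σ (τ * υ) ω +
          dTwo ρ₂.toTopRep zt σ τ υ =
        dTwo ρ₂.toTopRep zt (σ * τ) υ ω + dTwo ρ₂.toTopRep zt σ τ (υ * ω) at key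
      change f.hom (ρ₁ σ (h.inv (dTwo ρ₂.toTopRep zt τ υ ω)) + h.inv (dTwo ρ₂.toTopRep zt σ (τ * υ) ω) +
          h.inv (dTwo ρ₂.toTopRep zt σ τ υ)) =
        f.hom (h.inv (dTwo ρ₂.toTopRep zt (σ * τ) υ ω) + h.inv (dTwo ρ₂.toTopRep zt σ τ (υ * ω)))
      rw [map_add, map_add, map_add, ContinuousRep.hom_comm_apply f σ, h.f_inv (hd _ _ _),
        h.f_inv (hd _ _ _), h.f_inv (hd _ _ _), h.f_inv (hd _ _ _), h.f_inv (hd _ _ _)]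
      exact key⟩
  -- `H³(Γ, M₁) = 0`: `c = db`
  have hc : threeCocycleClass ρ₁.toTopRep c = 0 := Subsingleton.elim _ _
  obtain ⟨b, hb⟩ := (threeCocycleClass_eq_zero_iff_dTwo ρ₁.toTopRep c).1 hc
  have hb' : ∀ σ τ υ, dTwo ρ₂.toTopRep zt σ τ υ = f.hom (dTwo ρ₁.toTopRep b σ τ υ) := fun σ τ υ => by
    rw [← h.f_inv (hd σ τ υ)]
    exact congrArg f.hom (hb σ τ υ)
  -- the corrected lift `z̃ - f ∘ b` is a `2`-cocycle of `M₂` mapping to `z`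
  let fb : C(Γ × Γ, M₂) := (⟨f.hom, f.hom.continuous⟩ : C(M₁, M₂)).comp b
  have hfb : ∀ σ τ υ, dTwo ρ₂.toTopRep fb σ τ υ = f.hom (dTwo ρ₁.toTopRep b σ τ υ) := fun σ τ υ => by
    rw [dTwo_apply, dTwo_apply, map_sub, map_add, map_sub, TopRep.hom_comm_apply f σ]
    rfl
  let y : contTwoCocycles ρ₂.toTopRep :=
    ⟨zt - fb, (mem_contTwoCocycles_iff_dTwo ρ₂.toTopRep _).2 fun σ τ υ => by
      rw [dTwo_sub, hb', hfb, sub_self]⟩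
  refine ⟨twoCocycleClass _ y, ?_⟩
  rw [cohomologyMap_twoCocycleClass]
  refine congrArg _ (Subtype.ext (ContinuousMap.ext fun p => ?_))
  change g.hom (zt p - f.hom (b p)) = z.1 p
  rw [map_sub, hzt, h.g_f_apply, sub_zero]

/-- `H²(g)` is surjective when `H³(Γ, M₁) = 0`. [cite: SerreGaloisCohomology1997, I §2.2] -/
theorem map_two_surjective_of_subsingleton_three (h : IsSES f g)
    [Subsingleton (continuousCohomology 3 ρ₁.toTopRep)] :
    Surjective (cohomologyMap g 2) :=
  h.exists_map_two_eq_of_subsingleton_three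

omit [LocallyCompactSpace Γ] in
/-- **`H¹(g) ∘ H¹(f) = 0`.** [cite: SerreGaloisCohomology1997, I §2.2] -/
theorem map_one_map_one (h : IsSES f g) (x : continuousCohomology 1 ρ₁.toTopRep) :
    cohomologyMap g 1 (cohomologyMap f 1 x) = 0 := by
  obtain ⟨φ, rfl⟩ := oneCocycleClass_surjective _ x
  rw [cohomologyMap_oneCocycleClass, cohomologyMap_oneCocycleClass, oneCocycleClass_eq_zero_iff]
  refine ⟨0, fun σ => ?_⟩
  rw [pullback_id_resIdHom_apply, pullback_id_resIdHom_apply, h.g_f_apply, map_zero, sub_zero]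

/-- **`H²(g) ∘ H²(f) = 0`.** [cite: SerreGaloisCohomology1997, I §2.2] -/
theorem map_two_map_two (h : IsSES f g) (x : continuousCohomology 2 ρ₁.toTopRep) :
    cohomologyMap g 2 (cohomologyMap f 2 x) = 0 := by
  obtain ⟨c, rfl⟩ := twoCocycleClass_surjective _ x
  rw [cohomologyMap_twoCocycleClass, cohomologyMap_twoCocycleClass, twoCocycleClass_eq_zero_iff]
  refine ⟨0, fun σ τ => ?_⟩
  change g.hom (f.hom (c.1 (σ, τ))) = ρ₃.toTopRep.ρ σ ((0 : C(Γ, M₃)) τ) - (0 : C(Γ, M₃)) (σ * τ) +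
    (0 : C(Γ, M₃)) σ
  rw [h.g_f_apply, ContinuousMap.zero_apply, ContinuousMap.zero_apply, ContinuousMap.zero_apply,
    map_zero, sub_zero, add_zero]

/-- **The Euler-characteristic count along the nine-term sequence** (Milne, *ADT* I §2, proof of
Thm. 2.8: "both sides are additive in `M`"; Serre II §5.4): for a short exact sequence
`0 → M₁ → M₂ → M₃ → 0` of discrete `Γ`-modules with `H³(Γ, M₁) = 0` and all of
`M₂, M₃, H¹(Mᵢ), H²(M₁), H²(M₂)` finite,
`#M₁^Γ · #M₃^Γ · #H¹(M₂) · #H²(M₁) · #H²(M₃) = #M₂^Γ · #H¹(M₁) · #H¹(M₃) · #H²(M₂)`.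
[cite: MilneADT2006, I §2 Thm. 2.8 (proof)] [cite: SerreGaloisCohomology1997, I §2.2, II §5.4] -/
theorem card_nineTerm (h : IsSES f g) [Subsingleton (continuousCohomology 3 ρ₁.toTopRep)]
    [Finite M₂] [Finite M₃]
    [Finite (continuousCohomology 1 ρ₁.toTopRep)] [Finite (continuousCohomology 1 ρ₂.toTopRep)]
    [Finite (continuousCohomology 1 ρ₃.toTopRep)] [Finite (continuousCohomology 2 ρ₁.toTopRep)]
    [Finite (continuousCohomology 2 ρ₂.toTopRep)] :
    Nat.card ρ₁.toTopRep.ρ.invariants * Nat.card ρ₃.toTopRep.ρ.invariants *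
        Nat.card (continuousCohomology 1 ρ₂.toTopRep) * Nat.card (continuousCohomology 2 ρ₁.toTopRep) *
        Nat.card (continuousCohomology 2 ρ₃.toTopRep) =
      Nat.card ρ₂.toTopRep.ρ.invariants * Nat.card (continuousCohomology 1 ρ₁.toTopRep) *
        Nat.card (continuousCohomology 1 ρ₃.toTopRep) * Nat.card (continuousCohomology 2 ρ₂.toTopRep) := by
  classical
  -- the eight maps of the sequence, as additive homomorphisms
  let ι₀ : ρ₁.toTopRep.ρ.invariants →+ ρ₂.toTopRep.ρ.invariants :=
    { toFun := fun w => ⟨f.hom (w : M₁), fun σ => by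
        change ρ₂ σ (f.hom (w : M₁)) = f.hom (w : M₁)
        rw [← ContinuousRep.hom_comm_apply f σ]
        exact congrArg f.hom (w.2 σ)⟩
      map_zero' := Subtype.ext (show f.hom ((0 : ρ₁.toTopRep.ρ.invariants) : M₁) = (0 : M₂) by
        rw [Submodule.coe_zero, map_zero])
      map_add' := fun a b => Subtype.ext (show f.hom ((a + b : ρ₁.toTopRep.ρ.invariants) : M₁) =
          f.hom (a : M₁) + f.hom (b : M₁) by rw [Submodule.coe_add, map_add]) }
  let π₀ : ρ₂.toTopRep.ρ.invariants →+ ρ₃.toTopRep.ρ.invariants :=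
    { toFun := fun w => ⟨g.hom (w : M₂), fun σ => by
        change ρ₃ σ (g.hom (w : M₂)) = g.hom (w : M₂)
        rw [← ContinuousRep.hom_comm_apply g σ]
        exact congrArg g.hom (w.2 σ)⟩
      map_zero' := Subtype.ext (show g.hom ((0 : ρ₂.toTopRep.ρ.invariants) : M₂) = (0 : M₃) by
        rw [Submodule.coe_zero, map_zero])
      map_add' := fun a b => Subtype.ext (show g.hom ((a + b : ρ₂.toTopRep.ρ.invariants) : M₂) =
          g.hom (a : M₂) + g.hom (b : M₂) by rw [Submodule.coe_add, map_add]) }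
  let d₀ : ρ₃.toTopRep.ρ.invariants →+ continuousCohomology 1 ρ₁.toTopRep := h.δ₀.toAddMonoidHom
  let f₁ : continuousCohomology 1 ρ₁.toTopRep →+ continuousCohomology 1 ρ₂.toTopRep :=
    (cohomologyMap f 1).hom.toLinearMap.toAddMonoidHom
  let g₁ : continuousCohomology 1 ρ₂.toTopRep →+ continuousCohomology 1 ρ₃.toTopRep :=
    (cohomologyMap g 1).hom.toLinearMap.toAddMonoidHom
  let d₁ : continuousCohomology 1 ρ₃.toTopRep →+ continuousCohomology 2 ρ₁.toTopRep := h.δ₁.toAddMonoidHom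
  let f₂ : continuousCohomology 2 ρ₁.toTopRep →+ continuousCohomology 2 ρ₂.toTopRep :=
    (cohomologyMap f 2).hom.toLinearMap.toAddMonoidHom
  let g₂ : continuousCohomology 2 ρ₂.toTopRep →+ continuousCohomology 2 ρ₃.toTopRep :=
    (cohomologyMap g 2).hom.toLinearMap.toAddMonoidHom
  -- exactness, term by term
  have hι₀ : Injective ι₀ := fun a b hab =>
    Subtype.ext (h.injective (congrArg (fun w : ρ₂.toTopRep.ρ.invariants => (w : M₂)) hab))
  have e₁ : Nat.card ρ₂.toTopRep.ρ.invariants = Nat.card ι₀.range * Nat.card π₀.range := by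
    refine card_eq_card_range_mul_of_exact ι₀ π₀ (fun a => Subtype.ext (h.g_f_apply a)) fun w hw => ?_
    have hw' : g.hom (w : M₂) = 0 := congrArg (fun v : ρ₃.toTopRep.ρ.invariants => (v : M₃)) hw
    obtain ⟨x, hx⟩ := h.exact_mid (w : M₂) hw'
    refine ⟨⟨x, fun σ => h.injective ?_⟩, Subtype.ext hx⟩
    change f.hom (ρ₁ σ x) = f.hom x
    rw [ContinuousRep.hom_comm_apply f σ, hx]
    exact w.2 σ
  have e₂ : Nat.card ρ₃.toTopRep.ρ.invariants = Nat.card π₀.range * Nat.card d₀.range := by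
    refine card_eq_card_range_mul_of_exact π₀ d₀ (fun w => ?_) fun v hv => ?_
    · exact (h.δ₀_eq_zero_iff _).2 ⟨(w : M₂), w.2, rfl⟩
    · obtain ⟨w, hw, hwv⟩ := (h.δ₀_eq_zero_iff v).1 hv
      exact ⟨⟨w, hw⟩, Subtype.ext hwv⟩
  have e₃ : Nat.card (continuousCohomology 1 ρ₁.toTopRep) = Nat.card d₀.range * Nat.card f₁.range :=
    card_eq_card_range_mul_of_exact d₀ f₁ (fun v => h.map_one_δ₀ v)
      fun x hx => h.exists_δ₀_eq_of_map_one_eq_zero x hx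
  have e₄ : Nat.card (continuousCohomology 1 ρ₂.toTopRep) = Nat.card f₁.range * Nat.card g₁.range :=
    card_eq_card_range_mul_of_exact f₁ g₁ (fun x => h.map_one_map_one x)
      fun y hy => h.exists_map_one_eq_of_map_one_eq_zero y hy
  have e₅ : Nat.card (continuousCohomology 1 ρ₃.toTopRep) = Nat.card g₁.range * Nat.card d₁.range :=
    card_eq_card_range_mul_of_exact g₁ d₁ (fun y => h.δ₁_map_one y)
      fun x hx => h.exists_map_one_eq_of_δ₁_eq_zero x hx
  have e₆ : Nat.card (continuousCohomology 2 ρ₁.toTopRep) = Nat.card d₁.range * Nat.card f₂.range :=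
    card_eq_card_range_mul_of_exact d₁ f₂ (fun x => h.map_two_δ₁ x)
      fun z hz => h.exists_δ₁_eq_of_map_two_eq_zero z hz
  have e₇ : Nat.card (continuousCohomology 2 ρ₂.toTopRep) = Nat.card f₂.range * Nat.card g₂.range :=
    card_eq_card_range_mul_of_exact f₂ g₂ (fun x => h.map_two_map_two x)
      fun w hw => h.exists_map_two_eq_of_map_two_eq_zero w hw
  have e₀ : Nat.card ρ₁.toTopRep.ρ.invariants = Nat.card ι₀.range := (card_range_of_injective' ι₀ hι₀).symm
  have e₈ : Nat.card (continuousCohomology 2 ρ₃.toTopRep) = Nat.card g₂.range :=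
    (card_range_of_surjective' g₂ h.map_two_surjective_of_subsingleton_three).symm
  rw [e₀, e₁, e₂, e₃, e₄, e₅, e₆, e₇, e₈]
  ring

end IsSES

end NineTerm

end Literature.NumberTheory.GaloisRepresentations

end
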